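import Summits.AtomisticToContinuum.Crystallization.Theorems.FreeSplittingCertificatesStrictSplittingRuleP1ReadTable

/-!
# `StrictSplittingRule` (stmt-AtomisticToContinuum-12560): the ROUTED readout — a bond paid through intermediate sites splits into LEGS with factor `2/3` (P1 interpolant object, part 38)

Route `FreeSplittingCertificates`, crux r3 `StrictSplittingRule` (H12⋆ = `stub_coreJointCoercive`), unit b2b-freesplit-B gen 31.
VALUE = the other half of the certified far ledger's readout bookkeeping (HOME CERT §28 (3)(B), §31; `cellval.py` "slanted vertical route"): the
vertical Bravais bond `(q, q + (2,0,0))` is not an edge of any cell, so its readout `|V(q+(2,0,0)) − V(q)|²` is routed through the three intermediate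
sites `b₁, b₂, b₃` of the adjacent layer, each two-leg path `q → bᵢ → q + (2,0,0)` bounding it by `2(|V bᵢ − V q|² + |V(q+(2,0,0)) − V bᵢ|²)`; averaging
over the three paths gives the legs the factor `fac = 2/3` of the certificate.  Stated for ARBITRARY intermediate offsets (no parity case analysis):
* **`fpSq_sub_le_two_mul`**: `|x − z|² ≤ 2(|x − y|² + |y − z|²)`;
* **`fpSq_route_le_legs`**: `|V(q+s) − V q|² ≤ (2/3)·Σ_{i<3} (|V(q + oᵢ) − V q|² + |V(q+s) − V(q + oᵢ)|²)` for any offsets `o : Fin 3 → ℤ³`;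
* **`tsum_readout_route_le_legs`**: the weighted sum over `q` of the left side is bounded by that of the right side (summability of the leg family assumed),
  after which every leg is an edge and `tsum_readout_leg_table_le` (part 37) distributes it over its carrier cells.
NOT a proof of H12⋆, NOT summit progress.  [folklore]
-/

noncomputable section

open Set Function
open scoped BigOperators

namespace Summit.AtomisticToContinuum.Crystallization.Theorems.StrictSplittingRuleBirth

open Literature.MathematicalPhysics.StatisticalMechanics
open Summit.AtomisticToContinuum.Crystallization.Theorems.PalmUnimodularRigidity.LayeredLawsSelectHcp

/-- `|x − z|² ≤ 2(|x − y|² + |y − z|²)` for the explicit three-component square norm `fpSq`. NOT summit progress. -/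
theorem fpSq_sub_le_two_mul (x y z : Fin 3 → ℝ) :
    fpSq (fun k => x k - z k) ≤ 2 * (fpSq (fun k => x k - y k) + fpSq (fun k => y k - z k)) := by
  unfold fpSq
  nlinarith [sq_nonneg (x 0 - y 0 - (y 0 - z 0)), sq_nonneg (x 1 - y 1 - (y 1 - z 1)), sq_nonneg (x 2 - y 2 - (y 2 - z 2))]

/-- **Routed readout, one bond**: for lattice values `V`, a bond `(q, q+s)` and ANY three intermediate offsets `o i`,
`|V(q+s) − V q|² ≤ (2/3)·Σ_i (|V(q+oᵢ) − V q|² + |V(q+s) − V(q+oᵢ)|²)`.  NOT a proof of H12⋆, NOT summit progress. -/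
theorem fpSq_route_le_legs (V : ℤ × ℤ × ℤ → (Fin 3 → ℝ)) (q s : ℤ × ℤ × ℤ) (o : Fin 3 → ℤ × ℤ × ℤ) :
    fpSq (fun k => V (q + s) k - V q k) ≤
      2 / 3 * ∑ i : Fin 3, (fpSq (fun k => V (q + o i) k - V q k) + fpSq (fun k => V (q + s) k - V (q + o i) k)) := by
  have h : ∀ i : Fin 3, fpSq (fun k => V (q + s) k - V q k) ≤
      2 * (fpSq (fun k => V (q + o i) k - V q k) + fpSq (fun k => V (q + s) k - V (q + o i) k)) := by
    intro i
    have := fpSq_sub_le_two_mul (V (q + s)) (V (q + o i)) (V q)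
    have e1 : fpSq (fun k => V (q + o i) k - V q k) = fpSq (fun k => V (q + o i) k - V q k) := rfl
    have e2 : fpSq (fun k => V (q + s) k - V (q + o i) k) = fpSq (fun k => V (q + s) k - V (q + o i) k) := rfl
    linarith
  rw [Fin.sum_univ_three]
  linarith [h 0, h 1, h 2]

/-- **Routed readout, summed**: for nonnegative bond weights `wv` and any offset table `o q i`,
`Σ'_q wv q·|V(q+s) − V q|² ≤ Σ'_q (2/3)·wv q·Σ_i (|V(q+o q i) − V q|² + |V(q+s) − V(q+o q i)|²)` provided the right side is summable; the left side is then
summable too.  NOT a proof of H12⋆, NOT summit progress. -/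
theorem tsum_readout_route_le_legs (V : ℤ × ℤ × ℤ → (Fin 3 → ℝ)) (s : ℤ × ℤ × ℤ) (o : (ℤ × ℤ × ℤ) → Fin 3 → ℤ × ℤ × ℤ)
    (wv : ℤ × ℤ × ℤ → ℝ) (hwv : ∀ q, 0 ≤ wv q)
    (hs : Summable fun q : ℤ × ℤ × ℤ =>
      2 / 3 * wv q * ∑ i : Fin 3, (fpSq (fun k => V (q + o q i) k - V q k) + fpSq (fun k => V (q + s) k - V (q + o q i) k))) :
    Summable (fun q => wv q * fpSq (fun k => V (q + s) k - V q k)) ∧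
    ∑' q, wv q * fpSq (fun k => V (q + s) k - V q k) ≤
      ∑' q, 2 / 3 * wv q * ∑ i : Fin 3, (fpSq (fun k => V (q + o q i) k - V q k) + fpSq (fun k => V (q + s) k - V (q + o q i) k)) := by
  have hle : ∀ q, wv q * fpSq (fun k => V (q + s) k - V q k) ≤
      2 / 3 * wv q * ∑ i : Fin 3, (fpSq (fun k => V (q + o q i) k - V q k) + fpSq (fun k => V (q + s) k - V (q + o q i) k)) := by
    intro q
    have := mul_le_mul_of_nonneg_left (fpSq_route_le_legs V q s (o q)) (hwv q)
    linarith
  have h0 : ∀ q, 0 ≤ wv q * fpSq (fun k => V (q + s) k - V q k) := fun q => mul_nonneg (hwv q) (fpSq_nonneg _)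
  have hsum : Summable (fun q => wv q * fpSq (fun k => V (q + s) k - V q k)) := Summable.of_nonneg_of_le h0 hle hs
  exact ⟨hsum, Summable.tsum_le_tsum hle hsum hs⟩

end Summit.AtomisticToContinuum.Crystallization.Theorems.StrictSplittingRuleBirth

end
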